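/-
Copyright (c) 2026. All rights reserved.
Released under Apache 2.0 license as described in the file LICENSE.
Authors: HodgeCM publication cell (pub-hodgecm), GR lane, seat GR-2 (`pub-hodgecm-own-hyp34`).
-/
import Literature.NumberTheory.GelbartRogawski1991.Prop311PrintedTransport
import Literature.NumberTheory.GelbartRogawski1991.UnitaryDualPairSplittingDatum
import Literature.NumberTheory.Automorphic.UnitaryGroupPairCharactersDet
import HarnessLib

/-!
# [GelbartRogawski1991, Prop. 3.1.1]: the printed `G = U(V, Φ)` as the dual pair `U(V) × U(1)` of the tree — the
# ADAPTER from `UnitaryDualPair.splittingDatum` (line second factor) to the transport `Prop311PrintedTransport`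

Topic `NumberTheory/GelbartRogawski1991`; namespace `Literature.NumberTheory.GelbartRogawski1991.Prop311`.
Definitions and proved lemmas only; nothing of [GelbartRogawski1991] is asserted; `Prop311AsPrinted` is untouched.

The tree records [GelbartRogawski1991, Prop. 3.1.1] (`SplittingDatum.CompatibleSplitting`) at the DUAL-PAIR data
`UnitaryDualPair.splittingDatum F E c N M e J_V J_W …` — big group `G₁ = U(J_V ⊗ J_W)` on `Fin N × Fin M`, symplectic
group of the Gram matrix `adelicGram e T_V T_W = reindex e e (T_V ⊗ 1 ⊗ₖ T_W ⊗ 1)`, `Mp = adelicMpCont` (smooth model),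
proved unconditionally at CM data by `GRConstruction.gru_shape` — while the statement-exact typing speaks of ONE unitary
group `G = U(V, Φ)`.  `Prop311PrintedTransport.compatibleSplitting_printedDatum_of_frame` accepts any datum on
`(Sp(𝐀ᴺ × 𝐀ᴺ, β_{T'}), Mp, U(J')(𝔸_F))` for arbitrary spellings `J'`, `T'` of the frame's form matrices.  This file feeds
it the dual pair with a LINE as second factor (`M = 1`, `T_W = 1`, `T_V = T = diag(-2 d fᵢ)`, an enumeration
`e : Fin N × Fin 1 ≃ Fin N` over the first factor):

* §1 `gram_line`, `adelicGram_line`, `reindex_kronecker_line`: with `T_W = 1` the big Gram matrices ARE `T`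
  (`reindex e e (T ⊗ₖ 1) = T`);
* §2 **`lineDatum`**: the datum `UnitaryDualPair.splittingDatum F E σ N 1 e (T ⊗ 1) 1 …` with its big group
  `G₁(𝔸_F) ≤ GL_{N×1}(𝔸_E)` replaced by `U(reindex e e (T ⊗ 1 ⊗ₖ 1))(𝔸_F) ≤ GL_N(𝔸_E)` along the tree's
  `UnitaryGroup.adelicPairEquiv e` (same `Sp`, same `Mp`, same `Sp_F(W)` and `i`), and
  **`compatibleSplitting_lineDatum`**: compatibility transports to it (`CompatibleSplitting.transport`; the rational
  points `G₁(F)` correspond under `reindex e`, `adelicPairEquiv_symm_toAdelic_mem_range`);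
* §3 `lineDatum` satisfies the hypotheses of the transport: `coe_lineDatum_toSp` (`ι` is `adelicToSymplectic`, by the
  tree's `coe_adelicToSymplectic_adelicPairEmb`), `lineDatum_ratPts`, `lineDatum_spRat`; whence
  **`printed_conclusion_of_dualPairLine`**: a compatible splitting for the tree's dual-pair datum with line second factor
  + the `Mp` comparison `φ : adelicMpCont → Mp_𝐀(W)_print` over `(frameSp b)⁻¹` ⇒ [GelbartRogawski1991, Prop. 3.1.1] AS
  PRINTED for `(V, Φ)`.

The CM case (`F = L⁺`, `σ` = complex conjugation, `δ = imagUnit L`, where `GRConstruction.gru_shape` supplies the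
compatible splitting of `cmSplittingDatum`) is then a specialisation of `printed_conclusion_of_dualPairLine` modulo
`φ` — the comparison between the smooth model `adelicMpCont` and the printed unitary `ρ_ψ` (not in this file).

## References
* [GelbartRogawski1991] S. Gelbart, J. Rogawski, Invent. Math. 105 (1991) 445–472, §3.1 p. 454 L17–42, §3.2 p. 457,
  Prop. 3.1.1 p. 455 L1–2.
* [Liu2021] Y. Liu, Camb. J. Math. 9 (2021), App. D §D.1 (`U(V) = U(V ⊗ E)` for a line `E`).
-/

set_option autoImplicit false

noncomputable section

open NumberField
open scoped TensorProduct Matrix Kronecker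
open Literature.NumberTheory.Automorphic
open Literature.NumberTheory.Automorphic.UnitaryGroup
open Literature.RepresentationTheory.HeisenbergGroup
open Literature.NumberTheory.Weil1964

namespace Literature.NumberTheory.GelbartRogawski1991

namespace Prop311

open QuadraticCoordinates

variable (F : Type) [Field F] [NumberField F]
variable (E : Type) [Field E] [NumberField E] [Algebra F E] [Algebra.IsQuadraticExtension F E]
variable (σ : E ≃ₐ[F] E) {δ : E} (hσδ : σ δ = -δ) (hδ : δ ≠ 0) {d : F} (hd : δ * δ = algebraMap F E d)
variable (V : Type) [AddCommGroup V] [Module F V] [Module E V] [IsScalarTower F E V]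
variable {n : ℕ} (b : Module.Basis (Fin n) E V)
variable (Φ : V →ₗ[F] V →ₗ[F] E) (f : Fin n → F)
variable (e : Fin n × Fin 1 ≃ Fin n) (he : ∀ k : Fin n, (e.symm k).1 = k)

/-! ## §1. With a line as second factor the big Gram matrices are `T` -/

section Gram

omit [NumberField F] in
include he in
/-- `reindex e e (T ⊗ₖ 1) = T` for an enumeration `e` of `Fin N × Fin 1` over the first factor (any commutative ring).
[cite: GelbartRogawski1991, §3.2 p. 457] -/
theorem reindex_kronecker_one {R : Type*} [CommRing R] (T : Matrix (Fin n) (Fin n) R) :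
    Matrix.reindex e e (T ⊗ₖ (1 : Matrix (Fin 1) (Fin 1) R)) = T := by
  ext i j
  rw [Matrix.reindex_apply, Matrix.submatrix_apply, Matrix.kroneckerMap_apply,
    Subsingleton.elim (e.symm i).2 (e.symm j).2, Matrix.one_apply_eq, mul_one, he, he]

omit [NumberField F] in
include he in
/-- `𝕋_F = T`: the rational big Gram matrix of `U(T) × U(1)` is `T`. [cite: GelbartRogawski1991, §3.2 p. 457] -/
theorem gram_line : UnitaryDualPair.gram F e (symplecticGram F d f) (1 : Matrix (Fin 1) (Fin 1) F) = symplecticGram F d f :=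
  reindex_kronecker_one e he _

include he in
/-- `𝕋 = T ⊗ 1 ∈ M_N(𝐀)`: the adelic big Gram matrix is the frame's `T ⊗ 𝐀`. [cite: GelbartRogawski1991, §3.2 p. 457] -/
theorem adelicGram_line :
    UnitaryDualPair.adelicGram F e (symplecticGram F d f) (1 : Matrix (Fin 1) (Fin 1) F) =
      (symplecticGram F d f).map (algebraMap F (AdeleRing (𝓞 F) F)) := by
  rw [UnitaryDualPair.adelicGram_eq_map, gram_line F f e he]

omit [NumberField F] [NumberField E] [Algebra.IsQuadraticExtension F E] in
include he in
/-- `reindex e e (T ⊗ 1 ⊗ₖ 1) = T ⊗ 1 ∈ M_N(E)`: the hermitian matrix of the big group is the frame's `T ⊗_F E`.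
[cite: GelbartRogawski1991, §3.2 p. 457] -/
theorem reindex_kronecker_line :
    Matrix.reindex e e ((symplecticGram F d f).map (algebraMap F E) ⊗ₖ (1 : Matrix (Fin 1) (Fin 1) E)) =
      (symplecticGram F d f).map (algebraMap F E) :=
  reindex_kronecker_one e he _

omit [NumberField F] [NumberField E] [Algebra.IsQuadraticExtension F E] in
/-- `1 = 1 ⊗ 1` (the `hJW` equation of the dual-pair datum for the line). [cite: GelbartRogawski1991, §3.2 p. 457] -/
theorem one_eq_map_one : (1 : Matrix (Fin 1) (Fin 1) E) = (1 : Matrix (Fin 1) (Fin 1) F).map (algebraMap F E) :=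
  (Matrix.map_one _ (map_zero _) (map_one _)).symm

end Gram

/-! ## §2. The dual-pair datum with line second factor, read on `U(reindex e e (T ⊗ 1 ⊗ₖ 1))(𝔸_F)` -/

section Datum

variable (hT : IsUnit (symplecticGram F d f).det)

/-- the tree's dual-pair splitting datum for `U(T ⊗ 1) × U(1)` (second factor a line).
[cite: GelbartRogawski1991, §3.1 p. 454 L17–42, §3.2 p. 457] -/
abbrev pairLineDatum :=
  UnitaryDualPair.splittingDatum F E σ n 1 e ((symplecticGram F d f).map (algebraMap F E)) (1 : Matrix (Fin 1) (Fin 1) E)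
    hσδ hδ hd (isSymm_symplecticGram F d f) Matrix.isSymm_one hT
    (by rw [Matrix.det_one]; exact isUnit_one) rfl (one_eq_map_one F E)

/-- the identification `G₁(𝔸_F) = U(T ⊗ 1 ⊗ₖ 1)(𝔸_F) ≃* U(reindex e e (T ⊗ 1 ⊗ₖ 1))(𝔸_F) ≤ GL_N(𝔸_E)` of the tree.
[cite: GelbartRogawski1991, §3.2 p. 457] -/
abbrev pairLineEquiv :=
  UnitaryGroup.adelicPairEquiv F E σ n 1 e ((symplecticGram F d f).map (algebraMap F E)) (1 : Matrix (Fin 1) (Fin 1) E)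

omit [NumberField F] [Algebra.IsQuadraticExtension F E] in
/-- **rational points correspond under `reindex e`**: `(adelicPairEquiv e)⁻¹ (γ ⊗ 1) ∈ G₁(F)` for `γ ∈ U(reindex …)(F)`.
[cite: GelbartRogawski1991, §3.2 p. 457; Prop. 3.1.1 p. 455 L2] -/
theorem adelicPairEquiv_symm_toAdelic_mem_range
    (γ : UnitaryGroup.rational F E σ n
      (Matrix.reindex e e ((symplecticGram F d f).map (algebraMap F E) ⊗ₖ (1 : Matrix (Fin 1) (Fin 1) E)))) :
    (pairLineEquiv F E σ f e).symm
        (UnitaryGroup.toAdelic F E σ n _ γ) ∈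
      (UnitaryGroup.rationalPairToAdelic F E σ n 1 ((symplecticGram F d f).map (algebraMap F E))
        (1 : Matrix (Fin 1) (Fin 1) E)).range := by
  -- the rational preimage `reindex e⁻¹ γ`
  have hγ : UnitaryGroup.reindexGL e (UnitaryGroup.reindexGL e.symm (γ : GL (Fin n) E)) ∈
      unitaryGroupOfForm (σ : E →+* E)
        (Matrix.reindex e e ((symplecticGram F d f).map (algebraMap F E) ⊗ₖ (1 : Matrix (Fin 1) (Fin 1) E))) := by
    have h : UnitaryGroup.reindexGL e (UnitaryGroup.reindexGL e.symm (γ : GL (Fin n) E)) = (γ : GL (Fin n) E) :=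
      Units.ext (by simp only [UnitaryGroup.coe_reindexGL, ← Matrix.reindex_symm, Equiv.apply_symm_apply])
    rw [h]
    exact γ.2
  refine ⟨⟨UnitaryGroup.reindexGL e.symm (γ : GL (Fin n) E), (UnitaryGroup.reindexGL_mem_iff _ e _ _).1 hγ⟩,
    Subtype.ext (Units.ext ?_)⟩
  rw [UnitaryGroup.coe_rationalPairToAdelic, UnitaryGroup.coe_adelicPairEquiv_symm, UnitaryGroup.coe_reindexGL,
    UnitaryGroup.coe_reindexGL]
  rfl

/-- **`ι` on the reindexed big group is `adelicToSymplectic`** (pointwise, as automorphisms of `𝐀ᴺ × 𝐀ᴺ`): the tree's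
`coe_adelicToSymplectic_adelicPairEmb` read backwards through `adelicPairEquiv`.
[cite: GelbartRogawski1991, §3.1 p. 454 L37–42] -/
theorem coe_toSp_pairLineEquiv_symm
    (g : UnitaryGroup.adelic F E σ n
      (Matrix.reindex e e ((symplecticGram F d f).map (algebraMap F E) ⊗ₖ (1 : Matrix (Fin 1) (Fin 1) E)))) :
    (((pairLineDatum F E σ hσδ hδ hd f e hT).toSp ((pairLineEquiv F E σ f e).symm g) :
        symplecticGroup (polar (adelicForm F (Fin n)
          (UnitaryDualPair.adelicGram F e (symplecticGram F d f) (1 : Matrix (Fin 1) (Fin 1) F))))) :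
        ((Fin n → AdeleRing (𝓞 F) F) × (Fin n → AdeleRing (𝓞 F) F)) ≃ₗ[AdeleRing (𝓞 F) F]
          ((Fin n → AdeleRing (𝓞 F) F) × (Fin n → AdeleRing (𝓞 F) F))) =
      (adelicToSymplectic F E σ n hσδ hδ hd (isSymm_symplecticGram F d f) (reindex_kronecker_line F E f e he) g).1 := by
  have h := UnitaryGroup.coe_adelicToSymplectic_adelicPairEmb F E σ n 1 e ((symplecticGram F d f).map (algebraMap F E))
    (1 : Matrix (Fin 1) (Fin 1) E) hσδ hδ hd (isSymm_symplecticGram F d f) Matrix.isSymm_one rfl (one_eq_map_one F E)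
    (isSymm_symplecticGram F d f) (reindex_kronecker_line F E f e he) ((pairLineEquiv F E σ f e).symm g)
  rw [← UnitaryGroup.adelicPairEquiv_apply, MulEquiv.apply_symm_apply] at h
  rw [h, UnitaryDualPair.splittingDatum_toSp, UnitaryDualPair.toSp_apply, UnitaryGroup.coe_spReindex]

/-- **`lineDatum`**: the dual-pair datum for `U(T ⊗ 1) × U(1)` with its big group read on `GL_N(𝔸_E)` along
`adelicPairEquiv e` — same `Sp`, `Mp = adelicMpCont`, `Sp_F(W)` and `i`; `ι := ι₁ ∘ (adelicPairEquiv e)⁻¹`,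
`G(F) := toAdelic (U(reindex …)(F))`. [cite: GelbartRogawski1991, §3.1 p. 454 L17–42, §3.2 p. 457] -/
def lineDatum :
    SplittingDatum
      (symplecticGroup (polar (adelicForm F (Fin n)
        (UnitaryDualPair.adelicGram F e (symplecticGram F d f) (1 : Matrix (Fin 1) (Fin 1) F)))))
      (adelicMpCont F (Fin n) (UnitaryDualPair.adelicGram F e (symplecticGram F d f) (1 : Matrix (Fin 1) (Fin 1) F)))
      (UnitaryGroup.adelic F E σ n
        (Matrix.reindex e e ((symplecticGram F d f).map (algebraMap F E) ⊗ₖ (1 : Matrix (Fin 1) (Fin 1) E)))) where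
  proj := (pairLineDatum F E σ hσδ hδ hd f e hT).proj
  toSp := (pairLineDatum F E σ hσδ hδ hd f e hT).toSp.comp (pairLineEquiv F E σ f e).symm.toMonoidHom
  ratPts := (UnitaryGroup.toAdelic F E σ n _).range
  spRat := (pairLineDatum F E σ hσδ hδ hd f e hT).spRat
  toSp_mem_spRat := by
    rintro _ ⟨γ, rfl⟩
    rw [MonoidHom.comp_apply, MulEquiv.coe_toMonoidHom]
    exact (pairLineDatum F E σ hσδ hδ hd f e hT).toSp_mem_spRat _
      (adelicPairEquiv_symm_toAdelic_mem_range F E σ f e γ)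
  ratSplit := (pairLineDatum F E σ hσδ hδ hd f e hT).ratSplit
  proj_ratSplit := (pairLineDatum F E σ hσδ hδ hd f e hT).proj_ratSplit

/-- **compatibility transports to `lineDatum`** (identity on `Sp`, `Mp`; `(adelicPairEquiv e)⁻¹` on the big group).
[cite: GelbartRogawski1991, §3.1 Prop. 3.1.1 p. 455 L1–2; §3.2 p. 457] -/
theorem compatibleSplitting_lineDatum (h₀ : (pairLineDatum F E σ hσδ hδ hd f e hT).CompatibleSplitting) :
    (lineDatum F E σ hσδ hδ hd f e hT).CompatibleSplitting := by
  refine SplittingDatum.CompatibleSplitting.transport (D := pairLineDatum F E σ hσδ hδ hd f e hT)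
    (D' := lineDatum F E σ hσδ hδ hd f e hT) (MonoidHom.id _) (MonoidHom.id _) continuous_id
    (pairLineEquiv F E σ f e).symm.toMonoidHom
    (UnitaryGroup.continuous_adelicPairEquiv_symm F E σ n 1 e _ _) (fun _ => rfl) (fun _ => rfl) ?_ ?_ h₀
  · rintro _ ⟨γ, rfl⟩
    rw [MulEquiv.coe_toMonoidHom]
    exact adelicPairEquiv_symm_toAdelic_mem_range F E σ f e γ
  · intro x
    exact ⟨x, rfl⟩

/-- `lineDatum.toSp` is `adelicToSymplectic` pointwise. [cite: GelbartRogawski1991, §3.1 p. 454 L37–42] -/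
theorem coe_lineDatum_toSp
    (g : UnitaryGroup.adelic F E σ n
      (Matrix.reindex e e ((symplecticGram F d f).map (algebraMap F E) ⊗ₖ (1 : Matrix (Fin 1) (Fin 1) E)))) :
    (((lineDatum F E σ hσδ hδ hd f e hT).toSp g :
        symplecticGroup (polar (adelicForm F (Fin n)
          (UnitaryDualPair.adelicGram F e (symplecticGram F d f) (1 : Matrix (Fin 1) (Fin 1) F))))) :
        ((Fin n → AdeleRing (𝓞 F) F) × (Fin n → AdeleRing (𝓞 F) F)) ≃ₗ[AdeleRing (𝓞 F) F]
          ((Fin n → AdeleRing (𝓞 F) F) × (Fin n → AdeleRing (𝓞 F) F))) =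
      (adelicToSymplectic F E σ n hσδ hδ hd (isSymm_symplecticGram F d f) (reindex_kronecker_line F E f e he) g).1 :=
  coe_toSp_pairLineEquiv_symm F E σ hσδ hδ hd f e he hT g

/-- `lineDatum.ratPts = toAdelic (U(…)(F))`. [cite: GelbartRogawski1991, Prop. 3.1.1 p. 455 L2] -/
theorem lineDatum_ratPts :
    (lineDatum F E σ hσδ hδ hd f e hT).ratPts = (UnitaryGroup.toAdelic F E σ n _).range := rfl

/-- `lineDatum.spRat = range (Weil1964.ratSp 𝕋)`. [cite: GelbartRogawski1991, §3.1 p. 454 L35–36] -/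
theorem lineDatum_spRat :
    (lineDatum F E σ hσδ hδ hd f e hT).spRat =
      (Weil1964.ratSp F (UnitaryDualPair.adelicGram F e (symplecticGram F d f) (1 : Matrix (Fin 1) (Fin 1) F))
        (UnitaryDualPair.isUnit_det_adelicGram F e hT (by rw [Matrix.det_one]; exact isUnit_one))).range := rfl

/-- `lineDatum.proj = π` of the smooth metaplectic model. [cite: GelbartRogawski1991, §3.1 p. 454 L25] -/
theorem lineDatum_proj :
    (lineDatum F E σ hσδ hδ hd f e hT).proj =
      adelicMpCont.proj F (Fin n)
        (UnitaryDualPair.adelicGram F e (symplecticGram F d f) (1 : Matrix (Fin 1) (Fin 1) F)) := rfl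

end Datum

/-! ## §3. The printed proposition from the dual-pair datum with line second factor -/

section Printed

variable {S : Type} [NormedAddCommGroup S] [InnerProductSpace ℂ S]
variable (ρ : Representation ℂ (AdelicHeisenberg F E V Φ) S)
variable (i : ratSp F E V Φ →* adelicMp F E V Φ ρ) (hi : IsRationalSplitting F E V Φ ρ i)

include hi he in
/-- **[GelbartRogawski1991, Prop. 3.1.1] AS PRINTED from the tree's dual-pair datum with line second factor**: for the
printed data `(V, Φ)` with a `Φ`-orthogonal frame (`Φ(bᵢ, bᵢ) = fᵢ δ`, `fᵢ ≠ 0`), a compatible splitting of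
`UnitaryDualPair.splittingDatum F E σ N 1 e (T ⊗ 1) 1 …` (`T = diag(-2 d fᵢ)`) and a continuous model comparison
`φ : Mp_ψ(𝕎_𝐀)ᶜᵒⁿᵗ →* Mp_𝐀(W)` over `(frameSp b)⁻¹` give the two printed clauses of Prop. 3.1.1 for `(V, Φ, ρ, i)`.
[cite: GelbartRogawski1991, §3.1 p. 454 L17–42; Prop. 3.1.1 p. 455 L1–2] -/
theorem printed_conclusion_of_dualPairLine
    (hΦ₁ : ∀ (e : E) (x y : V), Φ (e • x) y = e * Φ x y) (hΦ₂ : ∀ (e : E) (x y : V), Φ x (e • y) = Φ x y * σ e)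
    (hb : ∀ i j, i ≠ j → Φ (b i) (b j) = 0) (hf : ∀ i, Φ (b i) (b i) = algebraMap F E (f i) * δ) (hf0 : ∀ i, f i ≠ 0)
    (hi! : ∀ i' : ratSp F E V Φ →* adelicMp F E V Φ ρ, IsRationalSplitting F E V Φ ρ i' → i' = i)
    (hT : IsUnit (symplecticGram F d f).det)
    (φ : adelicMpCont F (Fin n) (UnitaryDualPair.adelicGram F e (symplecticGram F d f) (1 : Matrix (Fin 1) (Fin 1) F)) →*
      adelicMp F E V Φ ρ) (hφ : Continuous φ)
    (hproj : ∀ m,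
      frameConj F E σ hσδ hδ hd V b ((proj F E V Φ ρ (φ m) : adelicSp F E V Φ) :
          AdelicSpace F V ≃ₗ[AdeleRing (𝓞 F) F] AdelicSpace F V) =
        ((adelicMpCont.proj F (Fin n)
            (UnitaryDualPair.adelicGram F e (symplecticGram F d f) (1 : Matrix (Fin 1) (Fin 1) F)) m :
            symplecticGroup (polar (adelicForm F (Fin n)
              (UnitaryDualPair.adelicGram F e (symplecticGram F d f) (1 : Matrix (Fin 1) (Fin 1) F))))) :
          ((Fin n → AdeleRing (𝓞 F) F) × (Fin n → AdeleRing (𝓞 F) F)) ≃ₗ[AdeleRing (𝓞 F) F]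
            ((Fin n → AdeleRing (𝓞 F) F) × (Fin n → AdeleRing (𝓞 F) F))))
    (h₀ : (pairLineDatum F E σ hσδ hδ hd f e hT).CompatibleSplitting) :
    (∃ s : adelicUnitary F E V Φ →* adelicMp F E V Φ ρ,
        ∀ g : adelicUnitary F E V Φ,
          projEnd F E V Φ ρ (s g) =
            ((g : AdelicSpace F V ≃ₗ[AdeleRing (𝓞 F) F] AdelicSpace F V) :
              AdelicSpace F V →ₗ[AdeleRing (𝓞 F) F] AdelicSpace F V)) ∧
      ∃ s : adelicUnitary F E V Φ →* adelicMp F E V Φ ρ,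
        Continuous s ∧
        (∀ g : adelicUnitary F E V Φ,
          projEnd F E V Φ ρ (s g) =
            ((g : AdelicSpace F V ≃ₗ[AdeleRing (𝓞 F) F] AdelicSpace F V) :
              AdelicSpace F V →ₗ[AdeleRing (𝓞 F) F] AdelicSpace F V)) ∧
        ∀ g : adelicUnitary F E V Φ,
          IsRationalPoint F E V Φ (g : AdelicSpace F V ≃ₗ[AdeleRing (𝓞 F) F] AdelicSpace F V) → s g ∈ i.range :=
  printed_conclusion_of_frame F E σ hσδ hδ hd V b Φ f ρ i hi hΦ₁ hΦ₂ hb hf hf0 hi! (reindex_kronecker_line F E f e he)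
    (adelicGram_line F f e he)
    (UnitaryDualPair.isUnit_det_adelicGram F e hT (by rw [Matrix.det_one]; exact isUnit_one))
    (lineDatum F E σ hσδ hδ hd f e hT) (coe_lineDatum_toSp F E σ hσδ hδ hd f e he hT) rfl rfl φ hφ hproj
    (compatibleSplitting_lineDatum F E σ hσδ hδ hd f e hT h₀)

end Printed

end Prop311

end Literature.NumberTheory.GelbartRogawski1991

end
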